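import Summits.QuantumAdvantage.QuantumAdvantage.Theorems.LinnikCubicClassGroupsDegreeOnePrimesEscapeDivisionPNTPi
import HarnessLib

/-!
# The `π`-form of the division prime number theorem: no exceptional term off the index-two subgroups

Topic `Summits/QuantumAdvantage/QuantumAdvantage/Theorems`, cell B2b-1 (linnik-cubic), PART A (gen 10);
helper toward the crux `DegreeOnePrimesEscape` (stmt-QuantumAdvantage-11543) of route
`LinnikCubicClassGroups`.  HONEST FRAMING: the value of this file is a THEOREM (kernel-checked, GRH-free,
Siegel-free, no hypothesis) — NOT summit progress.

Corollaries of `division_PNT_pi` (`π(x) = #{p ≤ x : p ∤ d_N, Frob_p ∈ Div σ}`, `δ = |Div σ|/|G|`, `Li = offsetLogIntegral`):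

* `division_pi_twoSided_of_forall_index_ne_two` — if `G = Gal(N/ℚ)` has NO subgroup of index two (e.g. `|G|`
  odd, `G` perfect) then `|π(x) − δ Li(x)| ≤ ε δ Li(x)` for every `σ` and every `x ≥ |d_N|^L`: the Chebotarev
  density theorem for divisions with relative error `ε` in the Linnik range, with no exceptional term
  (Heilbronn–Stark: an exceptional zero of `ζ_N` forces a quadratic subfield);
* `division_pi_ge_of_forall_index_two` — if `σ` lies in no index-two subgroup then
  `π(x) ≥ (1 − ε) δ Li(x)` for every `x ≥ |d_N|^L` (the exceptional term, if any, has the favourable sign).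

[cite: LagariasMontgomeryOdlyzko1979, Theorem 1.1] [cite: Stark1974, Theorem 3]
-/

noncomputable section

open scoped NumberField nonZeroDivisors
open Finset Real Ideal NumberField
open Literature.NumberTheory.NumberFields Literature.NumberTheory.LFunctions
  Literature.NumberTheory.LFunctions.NumberField

namespace Summit.QuantumAdvantage.QuantumAdvantage.Theorems.DegreeOnePrimesEscape

open scoped Classical in
/-- **No subgroup of index two ⟹ `|π(x) − δ Li(x)| ≤ ε δ Li(x)`** for every `σ` and every `x ≥ |d_N|^L`.
Unconditional. [cite: LagariasMontgomeryOdlyzko1979, Theorem 1.1] [cite: Stark1974, Theorem 3] -/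
theorem division_pi_twoSided_of_forall_index_ne_two (n : ℕ) (hn : 1 < n) {ε : ℝ} (hε : 0 < ε) (hε1 : ε ≤ 1) :
    ∃ L : ℝ, 0 < L ∧ ∀ (N : Type) [Field N] [NumberField N] [IsGalois ℚ N],
      Module.finrank ℚ N = n → (∀ K : Subgroup (N ≃ₐ[ℚ] N), K.index ≠ 2) → ∀ σ : N ≃ₐ[ℚ] N,
        ∀ x : ℝ, ((NumberField.discr N).natAbs : ℝ) ^ L ≤ x →
          |((((Nat.primesLE ⌊x⌋₊).filter
              (fun p : ℕ => ¬ ((p : ℤ) ∣ NumberField.discr N) ∧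
                ∃ (Q : Ideal (𝓞 N)) (_ : Q.IsMaximal) (_ : Q.LiesOver (span {(p : ℤ)})) (φ g : N ≃ₐ[ℚ] N),
                  IsArithFrobAt ℤ φ Q ∧ Q.inertia (N ≃ₐ[ℚ] N) = ⊥ ∧
                    Subgroup.zpowers (g * φ * g⁻¹) = Subgroup.zpowers σ)).card : ℕ) : ℝ) -
            (Nat.card {τ : N ≃ₐ[ℚ] N // ∃ g : N ≃ₐ[ℚ] N,
                Subgroup.zpowers (g * τ * g⁻¹) = Subgroup.zpowers σ} : ℝ) / Nat.card (N ≃ₐ[ℚ] N) *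
              offsetLogIntegral x| ≤
            ε * ((Nat.card {τ : N ≃ₐ[ℚ] N // ∃ g : N ≃ₐ[ℚ] N,
                Subgroup.zpowers (g * τ * g⁻¹) = Subgroup.zpowers σ} : ℝ) / Nat.card (N ≃ₐ[ℚ] N) *
              offsetLogIntegral x) := by
  obtain ⟨L, c, hL, hc, hc4, h⟩ := division_PNT_pi n hn hε hε1
  refine ⟨L, hL, fun N _ _ _ hN hG σ x hx => ?_⟩
  have hN1 : 1 < Module.finrank ℚ N := by rw [hN]; exact hn
  refine (h N hN σ).1 ?_ x hx
  rintro ⟨β₁, hζ₁, hβ₁c, hβ₁1⟩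
  obtain ⟨K₁, hK₁, -⟩ := exists_index_two_of_exceptional hN1 hc4 hζ₁ hβ₁c hβ₁1
  exact hG K₁ hK₁

open scoped Classical in
/-- **`σ` in no subgroup of index two ⟹ `π(x) ≥ (1 − ε) δ Li(x)`** for every `x ≥ |d_N|^L`.  Unconditional.
[cite: LagariasMontgomeryOdlyzko1979, Theorem 1.1] -/
theorem division_pi_ge_of_forall_index_two (n : ℕ) (hn : 1 < n) {ε : ℝ} (hε : 0 < ε) (hε1 : ε ≤ 1) :
    ∃ L : ℝ, 0 < L ∧ ∀ (N : Type) [Field N] [NumberField N] [IsGalois ℚ N],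
      Module.finrank ℚ N = n → ∀ σ : N ≃ₐ[ℚ] N,
        (∀ K : Subgroup (N ≃ₐ[ℚ] N), K.index = 2 → σ ∉ K) →
        ∀ x : ℝ, ((NumberField.discr N).natAbs : ℝ) ^ L ≤ x →
          (1 - ε) * (((Nat.card {τ : N ≃ₐ[ℚ] N // ∃ g : N ≃ₐ[ℚ] N,
              Subgroup.zpowers (g * τ * g⁻¹) = Subgroup.zpowers σ} : ℝ) / Nat.card (N ≃ₐ[ℚ] N)) *
              offsetLogIntegral x) ≤
          ((((Nat.primesLE ⌊x⌋₊).filter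
            (fun p : ℕ => ¬ ((p : ℤ) ∣ NumberField.discr N) ∧
              ∃ (Q : Ideal (𝓞 N)) (_ : Q.IsMaximal) (_ : Q.LiesOver (span {(p : ℤ)})) (φ g : N ≃ₐ[ℚ] N),
                IsArithFrobAt ℤ φ Q ∧ Q.inertia (N ≃ₐ[ℚ] N) = ⊥ ∧
                  Subgroup.zpowers (g * φ * g⁻¹) = Subgroup.zpowers σ)).card : ℕ) : ℝ) := by
  obtain ⟨L₀, c, hL₀, hc, hc4, h⟩ := division_PNT_pi n hn hε hε1
  set L : ℝ := max L₀ 1 with hL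
  refine ⟨L, lt_of_lt_of_le hL₀ (le_max_left _ _), fun N _ _ _ hN σ hσ x hx => ?_⟩
  obtain ⟨hA, hB⟩ := h N hN σ
  obtain ⟨hδ0, hδ1⟩ := divisionDensity_pos_le_one σ
  set δ : ℝ := (Nat.card {τ : N ≃ₐ[ℚ] N // ∃ g : N ≃ₐ[ℚ] N,
      Subgroup.zpowers (g * τ * g⁻¹) = Subgroup.zpowers σ} : ℝ) / Nat.card (N ≃ₐ[ℚ] N) with hδ
  have hN1 : 1 < Module.finrank ℚ N := by rw [hN]; exact hn
  set d : ℝ := ((NumberField.discr N).natAbs : ℝ) with hd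
  have hd3 : (3 : ℝ) ≤ d := three_le_natAbs_discr_real N hN1
  have hd1 : (1 : ℝ) ≤ d := by linarith
  have hx₀ : d ^ L₀ ≤ x := (Real.rpow_le_rpow_of_exponent_le hd1 (le_max_left _ _)).trans hx
  have hx3 : (3 : ℝ) ≤ x := by
    have := (Real.rpow_le_rpow_of_exponent_le hd1 (le_max_right L₀ 1)).trans hx
    rw [Real.rpow_one] at this; linarith
  have hx1 : 1 < x := by linarith
  by_cases hexc : ∃ β₁ : ℝ, dedekindZeta₁ N β₁ = 0 ∧ 1 - c / (Real.log d + Real.log 4) < β₁ ∧ β₁ < 1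
  · obtain ⟨β₁, hζ₁, hβ₁c, hβ₁1⟩ := hexc
    have hβ34 : 3 / 4 ≤ β₁ := three_quarters_le_of_window hc hc4 hd3 hβ₁c
    have hβ0 : 0 < β₁ := by linarith
    obtain ⟨K₁, hK₁, hHS⟩ := exists_index_two_of_exceptional hN1 hc4 hζ₁ hβ₁c hβ₁1
    have hζσ : dedekindZeta₁ (IntermediateField.fixedField (Subgroup.zpowers σ)) β₁ ≠ 0 := fun h0 =>
      hσ K₁ hK₁ ((hHS _).mp h0 (Subgroup.mem_zpowers σ))
    have hb := (hB β₁ hζ₁ hβ₁c hβ₁1).2 hζσ x hx₀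
    have h1 := (abs_le.mp hb).1
    -- `Li(x^β) ≥ 0` since `x^β > 1`... we only need `Li(x^β) ≥ Li(2)`-type positivity: `x^β ≥ 2`
    have hxβ : (2 : ℝ) ≤ x ^ β₁ := by
      have h9 : (3 : ℝ) ^ ((3 : ℝ) / 4) ≤ x ^ β₁ :=
        (Real.rpow_le_rpow (by norm_num) hx3 (by norm_num)).trans
          (Real.rpow_le_rpow_of_exponent_le hx1.le hβ34)
      have h8 : (2 : ℝ) ≤ (3 : ℝ) ^ ((3 : ℝ) / 4) := by
        have h16 : ((2 : ℝ) ^ (4 : ℕ) : ℝ) ≤ (3 : ℝ) ^ (3 : ℕ) := by norm_num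
        have : ((2 : ℝ) ^ (4 : ℝ)) ^ ((1 : ℝ) / 4) ≤ ((3 : ℝ) ^ (3 : ℝ)) ^ ((1 : ℝ) / 4) := by
          apply Real.rpow_le_rpow (by positivity) _ (by norm_num)
          rw [show (4 : ℝ) = ((4 : ℕ) : ℝ) by norm_num, show (3 : ℝ) = ((3 : ℕ) : ℝ) by norm_num,
            Real.rpow_natCast, Real.rpow_natCast]
          exact_mod_cast h16
        rw [← Real.rpow_mul (by norm_num), ← Real.rpow_mul (by norm_num)] at this
        norm_num at this
        exact this
      linarith
    have hLi0 : 0 ≤ offsetLogIntegral (x ^ β₁) := by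
      rw [offsetLogIntegral]
      exact intervalIntegral.integral_nonneg hxβ fun t ht => by
        have : 1 < t := by linarith [ht.1]
        exact inv_nonneg.mpr (Real.log_nonneg this.le)
    have h1ε : 0 ≤ 1 - ε := by linarith
    nlinarith [mul_nonneg h1ε (mul_nonneg hδ0.le hLi0)]
  · have hb := hA hexc x hx₀
    have h1 := (abs_le.mp hb).1
    nlinarith

end Summit.QuantumAdvantage.QuantumAdvantage.Theorems.DegreeOnePrimesEscape

end
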